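import Mathlib
import Summits.HodgeConjecture.FermatCycles.HodgeFermatNuOdd

/-!
# THEOREM (ν odd) sharpened to every prime `p ≥ 11`, `p ≠ 13` — the integrality step (`HodgeFermat/NuOddSharp.lean`)

Tree copy (whole module) of the module `HodgeFermat/NuOddSharp.lean` of the sibling cell's standalone package
`run/shared/lean/pub/pub-hodgefermat/lean/HodgeFermat/` (150 lines, sha256 `29f4052822ae9cff…`), source lines 17–150 (all).
Filed by cell `pub-hfermat`, seat prover-1 gen-0, on the COORDINATOR KEEPER RULING of 2026-08-25 (gem sweep H1: take the
off-gate kernel theorem `thmFstar` — `HodgeFermat/DecodingFinal.lean:29` — through the gate); this file is one link of the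
minimal import closure of `thmFstar`.  The source module's declarations are VERBATIM those of the cell record
`check/DecodingFinal_standalone.lean` (27 bodies, 454 223 B, sha256 dca6f17de93119a6…, hub `lean check` rc 0, 130.1 s; pub-hodgefermat `CERT.md` l.978, GATE HF-G32).
Deviations from the source module, exhaustively: the `import` lines (tree modules `Summits.HodgeConjecture.FermatCycles.
HodgeFermat*` instead of `HodgeFermat.*`); this module docstring; none besides imports and this docstring.
Every other line — in particular every declaration's statement and proof — is byte-identical to the source.
HONEST FRAMING: explicit algebraic cycles for specific Hodge classes on Fermat/Delsarte varieties; residual open instances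
listed; no claim on general Hodge.  (This file is arithmetic of CM types; it claims nothing about cycles.)

The source module's docstring (NuOddSharp.lean l.3–15), verbatim:

## "ν odd" and "Σν" at EVERY prime level p ≥ 11, p ≠ 13 (sharpening of `NuOdd`, generation 32)

`NuOdd.key` needs `p ≥ 17` for its support count (a unit outside the twelve residues `±entries`).  Here the
count is replaced by an INTEGRALITY argument: Fourier inversion (`NuOdd.totient_mul_add_neg`) at the unit `1` gives
`(p − 1)·(D(1) + D(−1)) = 2δ` with `δ = Σ_T χ₃ − Σ_T′ χ₃`, and `Σ_T χ₃ ∈ {0, ±3}` for a triple with `3 ∣ a + b + c`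
(`chi3_sum_cases`), so `δ ∈ {0, ±3, ±6}`; for `p ≥ 11`, `p ≠ 13` the only solution is `δ = 0` (`int_aux`:
`p − 1 ≥ 10` divides `2δ ∈ {0, ±6, ±12}` only if `δ = 0` or `p − 1 = 12`).  Hence `Σν` and `ν odd` hold at every
prime `p ≥ 11` except `p = 13` — and `p = 7, 13` are genuine exceptions (`p − 1 = 6, 12`; scan of HF-G31e: 42 / 8
failing pairs), `p = 11` is not.
* `nu_sum_eq'`, `nu_odd'` : as `NuOdd.nu_sum_eq`, `NuOdd.nu_odd` with `(hp11 : 11 ≤ p) (hp13 : p ≠ 13)` in place of `17 ≤ p`.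
Hypothesis `H0` only (light module).
-/

namespace HodgeFermat.KRFree.NuOddSharp

open HodgeFermat.KRFree.LemmaN HodgeFermat.KRFree.ChiThree HodgeFermat.KRFree.LemmaEMu
open HodgeFermat.KRFree.NuOdd

/-- `χ₃(a) + χ₃(b) + χ₃(c) ∈ {0, 3, −3}` when `3 ∣ a + b + c` -/
lemma chi3_sum_cases {a b c : ℕ} (h : 3 ∣ a + b + c) :
    chi3 a + chi3 b + chi3 c = 0 ∨ chi3 a + chi3 b + chi3 c = 3 ∨ chi3 a + chi3 b + chi3 c = -3 := by
  unfold chi3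
  have ha : a % 3 = 0 ∨ a % 3 = 1 ∨ a % 3 = 2 := by omega
  have hb : b % 3 = 0 ∨ b % 3 = 1 ∨ b % 3 = 2 := by omega
  have hc : c % 3 = 0 ∨ c % 3 = 1 ∨ c % 3 = 2 := by omega
  rcases ha with ha | ha | ha <;> rcases hb with hb | hb | hb <;> rcases hc with hc | hc | hc <;>
    simp [ha, hb, hc] <;> omega

/-- the integrality step: `t·n = 2k`, `t ≥ 10`, `t ≠ 12`, `k ∈ {0, ±3, ±6}` force `k = 0` -/
lemma int_aux {t n k : ℤ} (ht : 10 ≤ t) (ht12 : t ≠ 12) (h : t * n = 2 * k)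
    (hk : k = 0 ∨ k = 3 ∨ k = -3 ∨ k = 6 ∨ k = -6) : k = 0 := by
  rcases lt_trichotomy n 0 with hn | hn | hn
  · -- n ≤ -1: t·n ≤ -t ≤ -10, so 2k ≤ -10, k = -6, t·n = -12, n = -1, t = 12
    have h1 : t * n ≤ -t := by nlinarith
    have hk6 : k = -6 := by omega
    subst hk6
    have hn1 : n = -1 := by
      by_contra hne
      have hn2 : n ≤ -2 := by omega
      nlinarith
    subst hn1
    omega
  · subst hn; omega
  · have h1 : t ≤ t * n := by nlinarith
    have hk6 : k = 6 := by omega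
    subst hk6
    have hn1 : n = 1 := by
      by_contra hne
      have hn2 : 2 ≤ n := by omega
      nlinarith
    subst hn1
    omega

variable {p : ℕ}

/-- **THE KEY STEP at every prime p ≥ 11, p ≠ 13 (from H0)** — the conclusion of `NuOdd.key`. -/
theorem key' (h0 : H0) (hp : p.Prime) (hp11 : 11 ≤ p) (hp13 : p ≠ 13)
    {a b c a' b' c' : ℕ} (hs : 3 * p ∣ a + b + c) (hs' : 3 * p ∣ a' + b' + c')
    (ha : Nat.Coprime a p) (hb : Nat.Coprime b p) (hc : Nat.Coprime c p)
    (ha' : Nat.Coprime a' p) (hb' : Nat.Coprime b' p) (hc' : Nat.Coprime c' p)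
    (hT : SameType (3 * p) (a, b, c) (a', b', c')) :
    ((chi3 a + chi3 b + chi3 c : ℤ) : ℂ) = ((chi3 a' + chi3 b' + chi3 c' : ℤ) : ℂ) ∧
    ∀ u : (ZMod p)ˣ, ((nuFun (a, b, c) (u : ZMod p) - nuFun (a', b', c') (u : ZMod p) : ℤ) : ℂ)
      + ((nuFun (a, b, c) (-(u : ZMod p)) - nuFun (a', b', c') (-(u : ZMod p)) : ℤ) : ℂ) = 0 := by
  haveI : NeZero p := ⟨hp.ne_zero⟩
  haveI : Fact p.Prime := ⟨hp⟩
  have hp3 : p ≠ 3 := by omega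
  set F : ZMod p → ℂ := fun y => ((nuFun (a, b, c) y - nuFun (a', b', c') y : ℤ) : ℂ) with hFdef
  have hF : ∀ ψ : DirichletCharacter ℂ p, ψ.Even → ψ ≠ 1 → ∑ x : ZMod p, F x * ψ⁻¹ x = 0 :=
    fun ψ hψ hψ1 => hat_diff_eq_zero h0 hp hp3 ψ hψ hψ1 hs hs' ha hb hc ha' hb' hc' hT
  have inv := totient_mul_add_neg F hF
  -- the total mass δ
  have hδ : ∑ x : ZMod p, F x * (1 : DirichletCharacter ℂ p) x
      = ((chi3 a + chi3 b + chi3 c : ℤ) : ℂ) - ((chi3 a' + chi3 b' + chi3 c' : ℤ) : ℂ) := by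
    simp only [hFdef, nuFun, Int.cast_sub, Int.cast_add, sub_mul, add_mul, Finset.sum_sub_distrib,
      Finset.sum_add_distrib, sum_nuEntry_one ha, sum_nuEntry_one hb, sum_nuEntry_one hc, sum_nuEntry_one ha',
      sum_nuEntry_one hb', sum_nuEntry_one hc']
  -- integrality at the unit 1
  have h1 := inv 1
  rw [hδ, Units.val_one] at h1
  have hint : (p.totient : ℤ) * ((nuFun (a, b, c) (1 : ZMod p) - nuFun (a', b', c') (1 : ZMod p))
      + (nuFun (a, b, c) (-(1 : ZMod p)) - nuFun (a', b', c') (-(1 : ZMod p))))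
      = 2 * ((chi3 a + chi3 b + chi3 c) - (chi3 a' + chi3 b' + chi3 c')) := by
    have h1' := h1
    simp only [hFdef] at h1'
    exact_mod_cast h1'
  rw [Nat.totient_prime hp] at hint
  have ht : (10 : ℤ) ≤ ((p - 1 : ℕ) : ℤ) := by omega
  have ht12 : ((p - 1 : ℕ) : ℤ) ≠ 12 := by omega
  have h3 : 3 ∣ a + b + c := dvd_trans (Dvd.intro p rfl) hs
  have h3' : 3 ∣ a' + b' + c' := dvd_trans (Dvd.intro p rfl) hs'
  have hk : chi3 a + chi3 b + chi3 c - (chi3 a' + chi3 b' + chi3 c') = 0 ∨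
      chi3 a + chi3 b + chi3 c - (chi3 a' + chi3 b' + chi3 c') = 3 ∨
      chi3 a + chi3 b + chi3 c - (chi3 a' + chi3 b' + chi3 c') = -3 ∨
      chi3 a + chi3 b + chi3 c - (chi3 a' + chi3 b' + chi3 c') = 6 ∨
      chi3 a + chi3 b + chi3 c - (chi3 a' + chi3 b' + chi3 c') = -6 := by
    rcases chi3_sum_cases h3 with h | h | h <;> rcases chi3_sum_cases h3' with h' | h' | h' <;> omega
  have hδZ := int_aux ht ht12 hint hk
  have hδ0 : ((chi3 a + chi3 b + chi3 c : ℤ) : ℂ) - ((chi3 a' + chi3 b' + chi3 c' : ℤ) : ℂ) = 0 := by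
    have : ((chi3 a + chi3 b + chi3 c : ℤ) : ℂ) = ((chi3 a' + chi3 b' + chi3 c' : ℤ) : ℂ) := by
      have hz : (chi3 a + chi3 b + chi3 c : ℤ) = chi3 a' + chi3 b' + chi3 c' := by omega
      exact_mod_cast hz
    rw [this, sub_self]
  have h2δ : 2 * ∑ x : ZMod p, F x * (1 : DirichletCharacter ℂ p) x = 0 := by
    rw [hδ, hδ0, mul_zero]
  refine ⟨sub_eq_zero.mp hδ0, fun v => ?_⟩
  have hφ : (p.totient : ℂ) ≠ 0 := Nat.cast_ne_zero.mpr (Nat.totient_pos.mpr (NeZero.pos p)).ne'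
  have hv := inv v
  rw [h2δ] at hv
  exact (mul_eq_zero.mp hv).resolve_left hφ

/-- **THEOREM (Σν at every prime p ≥ 11, p ≠ 13; from H0).** -/
theorem nu_sum_eq' (h0 : H0) (hp : p.Prime) (hp11 : 11 ≤ p) (hp13 : p ≠ 13)
    {a b c a' b' c' : ℕ} (hs : 3 * p ∣ a + b + c) (hs' : 3 * p ∣ a' + b' + c')
    (ha : Nat.Coprime a p) (hb : Nat.Coprime b p) (hc : Nat.Coprime c p)
    (ha' : Nat.Coprime a' p) (hb' : Nat.Coprime b' p) (hc' : Nat.Coprime c' p)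
    (hT : SameType (3 * p) (a, b, c) (a', b', c')) :
    chi3 a + chi3 b + chi3 c = chi3 a' + chi3 b' + chi3 c' := by
  have h := (key' h0 hp hp11 hp13 hs hs' ha hb hc ha' hb' hc' hT).1
  exact_mod_cast h

/-- **THEOREM (ν odd at every prime p ≥ 11, p ≠ 13; from H0).**  `D(−x) = −D(x)` for `D = ν_T − ν_T′`. -/
theorem nu_odd' (h0 : H0) (hp : p.Prime) (hp11 : 11 ≤ p) (hp13 : p ≠ 13)
    {a b c a' b' c' : ℕ} (hs : 3 * p ∣ a + b + c) (hs' : 3 * p ∣ a' + b' + c')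
    (ha : Nat.Coprime a p) (hb : Nat.Coprime b p) (hc : Nat.Coprime c p)
    (ha' : Nat.Coprime a' p) (hb' : Nat.Coprime b' p) (hc' : Nat.Coprime c' p)
    (hT : SameType (3 * p) (a, b, c) (a', b', c')) (x : ZMod p) :
    nuFun (a, b, c) (-x) - nuFun (a', b', c') (-x) = -(nuFun (a, b, c) x - nuFun (a', b', c') x) := by
  haveI : NeZero p := ⟨hp.ne_zero⟩
  haveI : Fact p.Prime := ⟨hp⟩
  by_cases hx : x = 0
  · subst hx
    have ne : ∀ {y : ℕ}, Nat.Coprime y p → ((y : ℕ) : ZMod p) ≠ 0 := by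
      intro y hy h
      rw [ZMod.natCast_eq_zero_iff] at h
      exact hp.one_lt.ne' (Nat.Coprime.eq_one_of_dvd (Nat.coprime_comm.mp hy) h)
    have hz : ∀ {y : ℕ}, Nat.Coprime y p → nuEntry y (0 : ZMod p) = 0 := fun hy => nuEntry_eq_zero (ne hy)
    simp only [neg_zero, nuFun, hz ha, hz hb, hz hc, hz ha', hz hb', hz hc']
    simp
  · obtain ⟨u, rfl⟩ := isUnit_iff_ne_zero.mpr hx
    have h := (key' h0 hp hp11 hp13 hs hs' ha hb hc ha' hb' hc' hT).2 u
    have h' : ((nuFun (a, b, c) (-(u : ZMod p)) - nuFun (a', b', c') (-(u : ZMod p)) : ℤ) : ℂ)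
        = -(((nuFun (a, b, c) (u : ZMod p) - nuFun (a', b', c') (u : ZMod p) : ℤ) : ℂ)) := by
      linear_combination h
    exact_mod_cast h'

end HodgeFermat.KRFree.NuOddSharp
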